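import Summits.QuantumFields.YangMills.Theorems.UniversalDetectorHankelTransverse
import Summits.QuantumFields.YangMills.Theorems.UniversalDetectorHankelLongitudinal
import Summits.QuantumFields.YangMills.Theorems.UniversalDetectorTightPeelingPrep
import HarnessLib

/-!
# Route `UniversalDetector`, LINE g10-3 «transverse curvature» — the transverse unit step

Ideator seat ym-idea-8 (generation 10, lens «dual»).  Helper module for the support item
`Summit.QuantumFields.YangMills.Theses.UniversalDetector.CurvatureEdgeGlue` (stmt-QuantumFields-24088): the
TRANSVERSE STEP ESTIMATE `abs_cov_tstep_le`.  At a point `w` of the box with `‖a·w‖ ≥ η` inside the slab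
`|a·w_k| ≤ η/4`, a unit step of the plane two-point kernel `z ↦ Cov(P_p(0), P_q(z))` in the direction `e_k` costs at
most `a⁹ (C+M)/2`, where `C a⁸` is a far ceiling of the (transposed) DIAGONAL kernels on the time axis and `M a¹⁰` a
far bound of their transverse CONCAVITY DEFECT `curvDefect`.

Mechanism (reflection positivity only): some coordinate `i ≠ k` has `|a·w_i| ≥ η/2`; the transposition `(0 i)` makes
it the time (`cov_plane_swap`), the time reflection makes it positive (`cov_plane_zero_neg`, `curvDefect_neg`), and
then the transverse RP Cauchy–Schwarz inequality `sq_cov_plane_tstep_le` bounds the squared step by a far diagonal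
kernel value (`≥ 0` by RP, `≤ C a⁸`) times a far concavity defect (`≤ M a¹⁰`) — `abs_cov_tstep_le_core`.

HONEST FRAMING: lattice inequalities at fixed `β, L`; no continuum statement, no summit, rung or crux is proved.
Refs: Fröhlich–Israel–Lieb–Simon, Comm. Math. Phys. 62 (1978) Thm. 2.1; Osterwalder–Seiler, Ann. Phys. 110 (1978) §2.
-/

set_option autoImplicit false

noncomputable section

open MeasureTheory Filter Topology
open Literature.MathematicalPhysics.QuantumFieldTheory Literature.MathematicalPhysics.QuantumLattice
  Literature.Probability.LatticeModels
open Summit.QuantumFields.YangMills.Cruxes.OSLegsFromFemtoAndGap.DlrCollarTransfer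
open Summit.QuantumFields.YangMills.Cruxes.UniversalDetectorPlaneTight (cov_plane_zero_neg)
open Summit.QuantumFields.YangMills.Theorems.OSLegsFromFemtoAndGap (permPlane permPlane_valid)
open Summit.QuantumFields.YangMills.Cruxes.UniversalDetectorTightPeeling (norm_siteToE_le_two_mul norm_smul_siteToE)

namespace Summit.QuantumFields.YangMills.Cruxes.UniversalDetectorHankel

variable (G : Type) [Group G] [TopologicalSpace G] [IsTopologicalGroup G] [CompactSpace G]
  [MeasurableSpace G] [BorelSpace G] (r : LatticeRep G)

/-! ## §19 Scalar bookkeeping -/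

omit [Group G] [TopologicalSpace G] [IsTopologicalGroup G] [CompactSpace G] [MeasurableSpace G] [BorelSpace G] in
/-- Unscaling a far ceiling: `|a⁻⁸ X| ≤ C ⇒ |X| ≤ a⁸ |C|`. -/
theorem abs_le_pow_of_abs_inv_pow_mul_le {a C X : ℝ} (ha : 0 < a) (h : |a⁻¹ ^ 8 * X| ≤ C) : |X| ≤ a ^ 8 * |C| := by
  rw [abs_mul, abs_of_pos (pow_pos (inv_pos.2 ha) 8), inv_pow, ← div_eq_inv_mul, div_le_iff₀ (pow_pos ha 8)] at h
  nlinarith [le_abs_self C, pow_pos ha 8]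

omit [Group G] [TopologicalSpace G] [IsTopologicalGroup G] [CompactSpace G] [MeasurableSpace G] [BorelSpace G] in
/-- Unscaling the curvature bound: `a⁻²·(2·a⁻⁸X₁ − a⁻⁸X₂ − a⁻⁸X₃) ≤ M ⇒ 2X₁ − X₂ − X₃ ≤ a¹⁰ |M|`. -/
theorem defect_le_of_scaled {a M X₁ X₂ X₃ : ℝ} (ha : 0 < a)
    (h : a⁻¹ ^ 2 * (2 * (a⁻¹ ^ 8 * X₁) - a⁻¹ ^ 8 * X₂ - a⁻¹ ^ 8 * X₃) ≤ M) : 2 * X₁ - X₂ - X₃ ≤ a ^ 10 * |M| := by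
  have e : a⁻¹ ^ 2 * (2 * (a⁻¹ ^ 8 * X₁) - a⁻¹ ^ 8 * X₂ - a⁻¹ ^ 8 * X₃) = a⁻¹ ^ 10 * (2 * X₁ - X₂ - X₃) := by ring
  rw [e, inv_pow, ← div_eq_inv_mul, div_le_iff₀ (pow_pos ha 10)] at h
  nlinarith [le_abs_self M, pow_pos ha 10]

omit [Group G] [TopologicalSpace G] [IsTopologicalGroup G] [CompactSpace G] [MeasurableSpace G] [BorelSpace G] in
/-- A step vector read in the transposed frame: `e_k ∘ (0 i) = e_{(0 i) k}`. -/
theorem single_comp_swap (i k : Fin 4) (c : ℤ) (j : Fin 4) :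
    (Pi.single k c : Site 4) (Equiv.swap 0 i j) = (Pi.single (Equiv.swap 0 i k) c : Site 4) j := by
  simp only [Pi.single_apply]
  by_cases h : Equiv.swap 0 i j = k
  · rw [if_pos h, if_pos]; rw [← h, Equiv.swap_apply_self]
  · rw [if_neg h, if_neg]; intro h'; apply h; rw [h', Equiv.swap_apply_self]

/-- The defect is even in the transverse vector: `Δ_q^{−v} = Δ_q^{v}`. -/
theorem curvDefect_neg (β : ℝ) (L : ℕ) (q : Fin 4 × Fin 4) (v : Site 4) (t : ℤ) :
    curvDefect G r β L q (-v) t = curvDefect G r β L q v t := by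
  unfold curvDefect
  rw [← sub_eq_add_neg, sub_neg_eq_add]
  ring

/-! ## §20 One transverse step at a positive far time -/

/-- **Core step bound.**  `β ≥ 0`, `L ≥ 6`, species `p, q`, a spatial vector `v`, a unit `a ≤ η/4` with `a L ≥ η/2`;
if the diagonal kernel of `p` is `≤ a⁸ C` in absolute value at the lags `m ∈ [0, L]` with `a m ≥ η/4` and the defect
of `q` across `v` is `≤ a¹⁰ M` at the lags `t` with `a t ≥ η/4`, `a(2L+1−t) ≥ η/4`, then at every site `w` with
`w₀ ≤ L` and `a w₀ ≥ η/2`:  `|Cov_T(P_p 0, P_q w) − Cov_T(P_p 0, P_q(w+v))| ≤ a⁹ (C+M)/2`.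
[cite: FrohlichIsraelLiebSimon1978, Thm. 2.1] -/
theorem abs_cov_tstep_le_core {β : ℝ} (hβ : 0 ≤ β) {L : ℕ} (hL : 6 ≤ L) {p q : Fin 4 × Fin 4} (hp : p.1 < p.2)
    (hq : q.1 < q.2) (v : Site 4) (hv : v 0 = 0) {a η C M : ℝ} (ha : 0 < a) (haη : a ≤ η / 4)
    (haL : η / 2 ≤ a * L) (hC : 0 ≤ C) (hM : 0 ≤ M)
    (hpp : ∀ m : ℤ, 0 ≤ m → m ≤ L → η / 4 ≤ a * m → |diagCov G r β L p m| ≤ a ^ 8 * C)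
    (hqq : ∀ t : ℤ, η / 4 ≤ a * t → η / 4 ≤ a * (2 * L + 1 - t) → curvDefect G r β L q v t ≤ a ^ 10 * M)
    (w : Site 4) (hwL : w 0 ≤ L) (hw0 : η / 2 ≤ a * w 0) :
    |(torusE G r β L (fun V => plane G r p 0 V * plane G r q w V) -
          torusE G r β L (plane G r p 0) * torusE G r β L (plane G r q w)) -
        (torusE G r β L (fun V => plane G r p 0 V * plane G r q (w + v) V) -
          torusE G r β L (plane G r p 0) * torusE G r β L (plane G r q (w + v)))| ≤ a ^ 9 * (C + M) / 2 := by
  have hL1 : 1 ≤ L := by omega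
  have hη : 0 < η := by linarith
  have hδ0 := elec_nonneg p
  have hδ1 := elec_le_one p
  have hε0 := elec_nonneg q
  have hε1 := elec_le_one q
  obtain ⟨T, hT⟩ : ∃ T : ℤ, w 0 = T := ⟨_, rfl⟩
  rw [hT] at hwL hw0
  have hT1 : 1 ≤ T := by
    by_contra h
    have h' : (T : ℝ) ≤ 0 := by exact_mod_cast (by omega)
    nlinarith
  -- the split `T = s + δ_p + y₀` in halves
  set s : ℕ := ((T - elec p) / 2).toNat with hs
  have hs1 : 2 * (s : ℤ) ≤ T - elec p := by omega
  have hs3 : T - elec p ≤ 2 * (s : ℤ) + 1 := by omega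
  have hy0 : 0 ≤ w 0 - s - elec p := by rw [hT]; omega
  have hs2 : (s : ℤ) + 2 ≤ L := by omega
  have hy2 : w 0 - s - elec p + 2 ≤ L := by rw [hT]; omega
  have hsq := sq_cov_plane_tstep_le G r hβ hL1 hp hq w v hv s hy0 hs2 hy2
  rw [hT] at hsq
  -- the diagonal factor: non-negative (RP) and `≤ a⁸ C` (far ceiling)
  have hD0 : 0 ≤ diagCov G r β L p (2 * (s : ℤ) + elec p) := by
    have h := diagCov_mirror_nonneg G r hβ hL1 hp (n := 2 * s) (by omega)
    push_cast at h
    exact h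
  have hm_far : η / 4 ≤ a * ((2 * (s : ℤ) + elec p : ℤ) : ℝ) := by
    have h1 : (T : ℝ) - 1 ≤ ((2 * (s : ℤ) + elec p : ℤ) : ℝ) := by exact_mod_cast (by omega)
    nlinarith
  have hD1 : |diagCov G r β L p (2 * (s : ℤ) + elec p)| ≤ a ^ 8 * C :=
    hpp _ (by omega) (by omega) hm_far
  -- the defect factor: `≤ a¹⁰ M` at the far lag `t = 2 y₀ + δ_q ∈ [T−1, T+2]`
  have ht_far : η / 4 ≤ a * ((2 * (T - s - elec p) + elec q : ℤ) : ℝ) := by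
    have h1 : (T : ℝ) - 1 ≤ ((2 * (T - s - elec p) + elec q : ℤ) : ℝ) := by exact_mod_cast (by omega)
    nlinarith
  have ht_far' : η / 4 ≤ a * (2 * L + 1 - ((2 * (T - s - elec p) + elec q : ℤ) : ℝ)) := by
    have h1 : (L : ℝ) - 1 ≤ 2 * L + 1 - ((2 * (T - s - elec p) + elec q : ℤ) : ℝ) := by
      have : ((2 * (T - s - elec p) + elec q : ℤ) : ℝ) ≤ (L : ℝ) + 2 := by exact_mod_cast (by omega)
      linarith
    nlinarith
  have hΔ : curvDefect G r β L q v (2 * (T - s - elec p) + elec q) ≤ a ^ 10 * M := hqq _ ht_far ht_far'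
  -- conclude
  have hb : 0 ≤ a ^ 9 * (C + M) / 2 := by positivity
  rcases le_or_gt (curvDefect G r β L q v (2 * (T - s - elec p) + elec q)) 0 with hΔ0 | hΔpos
  · have h0 := hsq.trans (mul_nonpos_of_nonneg_of_nonpos hD0 hΔ0)
    have hX := pow_eq_zero_iff (n := 2) (by norm_num) |>.1 (le_antisymm h0 (sq_nonneg _))
    rw [hX, abs_zero]
    exact hb
  · have hD1' := (le_abs_self _).trans hD1
    have h1 := hsq.trans (mul_le_mul hD1' hΔ hΔpos.le (by positivity))
    have h2 : a ^ 8 * C * (a ^ 10 * M) ≤ (a ^ 9 * (C + M) / 2) ^ 2 := by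
      nlinarith [mul_nonneg (pow_nonneg ha.le 18) (sq_nonneg (C - M))]
    refine (sq_le_sq₀ (abs_nonneg _) hb).1 ?_
    rw [sq_abs]
    exact h1.trans h2

/-! ## §21 One transverse step anywhere in the slab -/

set_option maxHeartbeats 800000 in
/-- **Frame-free step bound.**  `β ≥ 0`, `L ≥ 6`, species `p, q`, direction `k`, unit `a ≤ η/4` with `a L ≥ η/2`;
uniform far ceilings `a⁸ C` for the diagonal kernels and `a¹⁰ M` for the axis defects of the transposed species
`P_i = (0 i)·p`, `Q_i = (0 i)·q` (all frames `i`, all spatial directions); then at every site `w` of the box with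
`‖a·w‖ ≥ η` and `|a·w_k| ≤ η/4`:  `|Cov_T(P_p 0, P_q w) − Cov_T(P_p 0, P_q(w + e_k))| ≤ a⁹ (C+M)/2`.
[cite: OsterwalderSeiler1978, §2] -/
theorem abs_cov_tstep_le {β : ℝ} (hβ : 0 ≤ β) {L : ℕ} (hL : 6 ≤ L) {p q : Fin 4 × Fin 4} (hp : p.1 < p.2)
    (hq : q.1 < q.2) (k : Fin 4) {a η C M : ℝ} (ha : 0 < a) (haη : a ≤ η / 4) (haL : η / 2 ≤ a * L) (hC : 0 ≤ C)
    (hM : 0 ≤ M)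
    (hDP : ∀ (i : Fin 4) (m : ℤ), 0 ≤ m → m ≤ L → η / 4 ≤ a * m →
      |diagCov G r β L (permPlane (Equiv.swap 0 i) p) m| ≤ a ^ 8 * C)
    (hDQ : ∀ (i : Fin 4) (m : ℤ), 0 ≤ m → m ≤ L → η / 4 ≤ a * m →
      |diagCov G r β L (permPlane (Equiv.swap 0 i) q) m| ≤ a ^ 8 * C)
    (hKP : ∀ (i k' : Fin 4), k' ≠ 0 → ∀ t : ℤ, η / 4 ≤ a * t → η / 4 ≤ a * (2 * L + 1 - t) →
      curvDefect G r β L (permPlane (Equiv.swap 0 i) p) (Pi.single k' 1) t ≤ a ^ 10 * M)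
    (hKQ : ∀ (i k' : Fin 4), k' ≠ 0 → ∀ t : ℤ, η / 4 ≤ a * t → η / 4 ≤ a * (2 * L + 1 - t) →
      curvDefect G r β L (permPlane (Equiv.swap 0 i) q) (Pi.single k' 1) t ≤ a ^ 10 * M)
    (w : Site 4) (hw : ∀ j, -(L : ℤ) ≤ w j ∧ w j ≤ L) (hfar : η ≤ ‖a • siteToE w‖)
    (hslab : |a * (w k : ℝ)| ≤ η / 4) :
    |(torusE G r β L (fun V => plane G r p 0 V * plane G r q w V) -
          torusE G r β L (plane G r p 0) * torusE G r β L (plane G r q w)) -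
        (torusE G r β L (fun V => plane G r p 0 V * plane G r q (w + Pi.single k 1) V) -
          torusE G r β L (plane G r p 0) * torusE G r β L (plane G r q (w + Pi.single k 1)))| ≤
      a ^ 9 * (C + M) / 2 := by
  have hη : 0 < η := by linarith
  -- a dominant coordinate `i`: `a |w_i| ≥ η/2`, hence `i ≠ k`
  obtain ⟨i, -, hi⟩ := Finset.exists_max_image Finset.univ (fun j : Fin 4 => |(w j : ℝ)|) Finset.univ_nonempty
  have hwi : η / 2 ≤ a * |(w i : ℝ)| := by
    have h2 := norm_siteToE_le_two_mul (abs_nonneg (w i : ℝ)) (fun j => hi j (Finset.mem_univ j))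
    rw [norm_smul_siteToE ha.le] at hfar
    nlinarith
  have hik : i ≠ k := by
    rintro rfl
    rw [abs_mul, abs_of_pos ha] at hslab
    linarith
  have hk' : Equiv.swap 0 i k ≠ 0 := by
    rw [Ne, Equiv.swap_apply_eq_iff, Equiv.swap_apply_left]; exact fun h => hik (h ▸ rfl)
  -- the transposed frame
  set w' : Site 4 := fun j => w (Equiv.swap 0 i j) with hw'
  set v' : Site 4 := Pi.single (Equiv.swap 0 i k) 1 with hv'
  have hv'0 : v' 0 = 0 := by rw [hv']; exact Pi.single_eq_of_ne (Ne.symm hk') _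
  have e0 := cov_plane_swap G r β L i p q w w' (fun j => rfl)
  have e1 := cov_plane_swap G r β L i p q (w + Pi.single k 1) (w' + v') (fun j => by
    rw [Pi.add_apply, Pi.add_apply, hv', ← single_comp_swap i k 1 j])
  rw [e0, e1]
  have hPv := permPlane_valid (Equiv.swap 0 i) hp
  have hQv := permPlane_valid (Equiv.swap 0 i) hq
  have hw'0 : w' 0 = w i := by rw [hw']; simp
  have hwiL := hw i
  rcases le_or_gt 0 (w i) with hpos | hneg
  · -- positive time: the core bound in the frame `(P_i, Q_i, e_{k'})`
    have hT : η / 2 ≤ a * (w' 0 : ℝ) := by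
      rw [hw'0]; rwa [abs_of_nonneg (by exact_mod_cast hpos : (0 : ℝ) ≤ w i)] at hwi
    exact abs_cov_tstep_le_core G r hβ hL hPv hQv v' hv'0 ha haη haL hC hM (hDP i) (hKQ i _ hk') w'
      (by rw [hw'0]; exact hwiL.2) hT
  · -- negative time: reflect (`p ↔ q`, `w' ↦ −w'`, `v' ↦ −v'`)
    have r0 := cov_plane_zero_neg r β L (permPlane (Equiv.swap 0 i) p) (permPlane (Equiv.swap 0 i) q) (-w')
    have r1 := cov_plane_zero_neg r β L (permPlane (Equiv.swap 0 i) p) (permPlane (Equiv.swap 0 i) q) (-(w' + v'))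
    rw [neg_neg] at r0 r1
    rw [r0, r1, neg_add]
    have hT : η / 2 ≤ a * ((-w') 0 : ℝ) := by
      rw [Pi.neg_apply, hw'0, Int.cast_neg]
      rwa [abs_of_neg (by exact_mod_cast hneg : ((w i : ℝ)) < 0)] at hwi
    have hneg0 : (-v') 0 = 0 := by rw [Pi.neg_apply, hv'0, neg_zero]
    exact abs_cov_tstep_le_core G r hβ hL hQv hPv (-v') hneg0 ha haη haL hC hM (hDQ i)
      (fun t ht ht' => by rw [curvDefect_neg]; exact hKP i _ hk' t ht ht') (-w')
      (by rw [Pi.neg_apply, hw'0]; omega) hT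

end Summit.QuantumFields.YangMills.Cruxes.UniversalDetectorHankel

end
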